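import Mathlib
import HarnessLib
import HarnessLib.Audit
import Summits.ValiantsHypothesis.Statement
import Literature.Computability.AlgebraicComplexity.DeterminantalComplexity

/-!
Route: PermanentClass

CLOSED (retired) 2026-08-15T13:51:34Z by operator:999:1257524 — reason: not-a-thesis: assembly does not conclude the sub-problem Statement — note: D-0027 §2.1 audit (human 2026-08-15: routes that do not decide the summit are removed): the assembly concludes `∃ ε : ℝ, 0 < ε ∧ ∃ n₀ : ℕ, ∀ n ≥ n₀, (n : ℝ) ^ (2 + ε) ≤ (Literature.Computability.AlgebraicComplexity.determinantalComplexity (Literature.Computability.Algebra`, not the sub-problem state. The file is kept as the record of this route; refuted decls are indexed as negative knowledge (`ledger negatives`).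

# Route PermanentClass — class of the permanental hypersurface at least n^(Omega(n^2)) gives
super-quadratic dc(per_n) by Sheshadri's kernel-incidence Bezout (engine for DetQP crux 2)

ENGINE ROUTE for route DetQP's rank-2 crux DetqpSuperquadratic (stmt-ValiantsHypothesis-0318: some ε
> 0 with n^(2+ε) ≤ dc(per_n)
for all large n), re-wanted here VERBATIM as the Target `DcPerSuperquadratic`; the Assembly ends in
that statement, not in
ValiantsHypothesis: closing it closes DetQP's hardest crux, it does not decide the summit, and the
method's ceiling is dc(per_n) ≥ c·n³.
It suffices to show X = X1 ∧ X2. X1 (KernelIncidenceBound; in print as arXiv:2606.13628 Thm 3(i), an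
unrefereed 2026 preprint, hence
filed as the FIRST crux): for every homogeneous f in N variables with an exact affine determinantal
representation of size m, every pencil
(a, b) and slice c, if the set of GENUINE POLAR POINTS T(f; a, b, c) = {x : f(x) = 0, c·x = 1, ∇f(x)
≠ 0, ∇f(x) ∈ span(a, b)} is finite
then #T ≤ B(m, N) := Σ_{i=1}^{N-1} C(m,i)·C(m-1,N-1-i)·C(N-2,i-1). X2 (PermanentClassExp =
arXiv:2606.13628 §10 Open Question (2)): the CLASS of
the permanental hypersurface P_n = Z(per_n) ⊂ P^(n²-1) — the degree of its dual hypersurface, equal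
to #T(per_n; a, b, c) for a generic
pencil — is at least n^(α·n²) for some α > 0 and all large n. With B(m, N) ≤ (4em/(N-1))^(N-1)
(ibid. Lemma 18) X yields
dc(per_n) ≥ (n²-1)·n^α/(4e), i.e. the Target with ε = α/2; the full-exponent form X2' =
PermanentClassFull ((εn)^(n²)) yields the card's
dc(per_n) ≥ c·n³ (support CubicFromFullClass). Card realised: class-conjecture-superquadratic-dc
(spine).
Lean: `KernelIncidenceBound ∧ PermanentClassExp`

## Assembly
Bookkeeping plus the arithmetic support (sorry-free shape checked in the planner's Sketch.lean,
where `Assembly = (KernelIncidenceBound →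
PermanentClassExp → BezoutToSuperquadratic → DcPerSuperquadratic)` holds by rfl): from
PermanentClassExp take α, n₀ and for n ≥ max(n₀, 2)
a pencil with finite genuine polar set T_n of size ≥ n^(αn²); KernelIncidenceBound at σ = Fin n ×
Fin n, f = per_n (homogeneous of degree n:
perPoly_isHomogeneous), m = dc(per_n) (attained: hasDetRepr_determinantalComplexity_holds), |σ| =
n·n gives #T_n ≤ B(dc(per_n), n·n); chain the
two inequalities and apply BezoutToSuperquadratic with m_n := dc(per_n). The conclusion is
stmt-ValiantsHypothesis-0318 verbatim (route DetQP,
crux DetqpSuperquadratic), NOT the summit: DetQP's own Assembly needs the qp-form DetqpThesis, which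
this engine cannot reach (ceiling n³).

Rationale: WHY THIS LINE. Every lower bound for dc(per_n) in print reads a DIMENSION off the hypersurface
Z(per_n) — Hessian rank (MignonRessayre2004), dual-variety
dimension (arXiv:1004.4802), singular-locus codimension (arXiv:1505.02205) — and is therefore capped
by the number of variables N = n²
(Landsberg2017 Rem 6.4.6.5). Sheshadri's 2026 kernel-incidence count (arXiv:2606.11090 for smooth
V(f), symmetric pencils; arXiv:2606.13628
Thm 3 for ARBITRARY affine determinants, singular fibres allowed) reads a DEGREE instead: genuine
polar points lift to isolated points of
the incidence {uᵀÂ(x) = 0, ΛÂ(x)v = 0, ℓ_t(uᵀÂ_i v) = 0} on P^N × P^(m-1) × P^(m-1), and refined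
multihomogeneous Bézout (Fulton1998 ch. 12
positivity for globally generated bundles) bounds their number by the binomial B(m, N), whose
(N-1)-st root turns an enumerative invariant
of size n^(Θ(N)) into m ≳ N·class^(1/N) — past the #variables wall; for Σ x_i^n this is a theorem
((n-1)²/4e, exact and border). For the
permanent the one missing input is the class of the singular hypersurface P_n, which
arXiv:2606.13628 §10 item 7 leaves open as its
Question (2); the dictionary is sharp at both ends: class ≥ 1 (dual nondegenerate: Landsberg2017
Lemma 6.4.6.3 with Segre's Prop 6.4.5.1,
in tree as rank_mrHess) returns exactly Mignon–Ressayre's n²/2 (B(m,N) > 0 iff m ≥ N/2), class ≥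
n^(αn²) gives n^(2+α), and the Plücker
maximum n(n-1)^(N-2) gives the ceiling n³/(4e). Imported area: projective duality and polar classes
of singular hypersurfaces (Piene1978)
plus Fulton–MacPherson intersection theory; no probabilistic/spectral reformulation is used. What it
adds to DetQP's engine (a) and to the
(empty) negatives index: ONE computable enumerative number with a decisive n = 3 falsifier, and a
typed home for Sheshadri's question.

RANKED CRUXES. #0 DcPerSuperquadratic (target) — route DetQP's crux DetqpSuperquadratic verbatim
(stmt-ValiantsHypothesis-0318): for some ε > 0 and all large n, n^(2+ε) ≤ dc(per_n) over ℂ.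
Re-wanted here so that this engine's Assembly lands on it (items dedup by signature). (why it might
fail: all engines in print saturate at Θ(n²) (MR04 Hessian, LMR13 dual dimension, ABV17 singular
locus; Landsberg2017 Rem 6.4.6.5) and dc(per_n) = O(n²) is excluded by nothing known; this engine
reaches it only if class(P_n) ≥ n^(Ω(n²)).) [MignonRessayre2004, arXiv:1004.4802, arXiv:1505.02205,
Landsberg2017, arXiv:2606.13628]
#2 KernelIncidenceBound (crux) — Sheshadri's determinantal conormal bound in elementary polar-count
form (card item P0, which claimed it as a new 'singular extension'; it is arXiv:2606.13628 Thm 3(i)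
+ Remark 3, no smoothness, reducible and non-reduced det Â allowed): for a finite index type σ with
N = |σ|, a form f ∈ ℂ[x_σ] homogeneous of degree d with HasDetRepr f m (f = det A, A an m×m matrix
of affine-linear forms), vectors a, b, c : σ → ℂ with a, b linearly independent, IF the genuine
polar set T = {x : f(x) = 0, Σ c_i x_i = 1, ∇f(x) ≠ 0, ∇f(x) ∈ span(a,b)} is finite THEN #T ≤ B(m,N)
= Σ_{j=0}^{N-2} C(m,j+1)·C(m-1,N-2-j)·C(N-2,j). Proof in print: homogenise Â = x₀A₀ + Σ x_i A_i, F =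
det Â = x₀^(m-d) f ≢ 0 (f = 0 gives T = ∅); each x ∈ T gives the point [1:x] of the cone over V(f),
a smooth point of V(F)_red on a multiplicity-one component with dF ≠ 0 (Lemma 2 dichotomy), hence a
'count point'; Steps 2–5 (rank m-1, kernel lift, generic Λ-reduction, Schur-complement local graph,
conormal identity ∂_iF = det B · uᵀÂ_i v) show its lift is an ISOLATED point of the square system
(isolated because T is finite near x — transversality of the flag is not needed, a non-reduced
isolated lift is charged its length ≥ 1), and Lemma 5 (Fulton: isolated zeros of a section of the
globally generated bundle O(1,1,0)^m ⊕ O(1,0,1)^(m-1) ⊕ O(0,1,1)^(N-2) ⊕ O(1,0,0) on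
P^N×P^(m-1)×P^(m-1) number at most the top Chern number) gives #T ≤ [H^N U^(m-1) V^(m-1)]
H(H+U)^m(H+V)^(m-1)(U+V)^(N-2) = B(m,N) (Step 6 closed form; reindex i = j+1). Zero polar sections
(non-concise f) are harmless for the same reason. Lean burden: refined multihomogeneous Bézout is
absent from Mathlib (XL); the local algebra is elementary. [difficulty: XL] (why it might fail: In
print only as an unrefereed, LLM-assisted 2026 preprint (arXiv:2606.13628 Thm 3(i)); delicate steps
are the generic Λ-reduction of the right-kernel block (Step 3, Rem 1) and Fulton positivity with
excess components (Lemma 5); as filed it also covers non-transverse finite pencils.)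
[arXiv:2606.13628, arXiv:2606.11090, Fulton1998, Piene1978]
#3 PermanentClassExp (crux) — CLASS CONJECTURE, exponent form (card item (C) weakened to what the
Target needs; = arXiv:2606.13628 §10 Open Question (2)): there are α > 0 and n₀ such that for every
n ≥ n₀ some pencil (a, b linearly independent) and slice c give a FINITE genuine polar set T(per_n;
a, b, c) = {x ∈ ℂ^(n×n) : per_n(x) = 0, Σ c_i x_i = 1, ∇per_n(x) ≠ 0, ∇per_n(x) ∈ span(a,b)} with #T
≥ n^(α·n²). Equivalently (generic pencils realise the maximum over finite ones; Z(per_n)^∨ is a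
hypersurface by Landsberg2017 Lemma 6.4.6.3 + Prop 6.4.5.1) the class deg Z(per_n)^∨ is ≥ n^(αn²).
This is the mathematical heart of the route; attack lines: Piene/Teissier polar-class formulas along
the torus-stable stratification of Sing(P_n) (transversal type A₁ along the top stratum: matrices
with two zero rows, normal form e₁ᵀ C e₂ with C the (n-2)-subpermanents), upper semicontinuity of
the class along GL-orbit degenerations (class(P_n) ≥ class of any orbit limit with nondegenerate
dual), torus-equivariant localisation of polar classes, and certified numerics at n = 3, 4.
[difficulty: open-problem] (why it might fail: Only class(P_n) ≥ 1 is known (dual nondegenerate);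
Sing(P_n) has codimension ≤ 2n and the Plücker–Teissier corrections it carries could collapse the
class to n^(o(n²)), the way Cramer's rule collapses det's dual to dimension 2n-2 — then the engine
returns only Θ(n²).) [arXiv:2606.13628, Landsberg2017, MignonRessayre2004, Piene1978,
arXiv:1505.02205]
#4 PermanentClassFull (crux) — CLASS CONJECTURE, full-exponent form (card item (C) as filed): there
are ε > 0 and n₀ such that for all n ≥ n₀ some finite genuine polar set of per_n (pencil a, b
linearly independent, slice c, as in PermanentClassExp) has at least (ε·n)^(n²) points, i.e.
class(P_n) ≥ (εn)^(n²) — within a factor ε^(n²) of the smooth Plücker value n(n-1)^(n²-2). With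
KernelIncidenceBound this gives the card's dc(per_n) ≥ ε·n³/(8e) (support CubicFromFullClass), the
maximal reach of the method. [deps: PermanentClassExp] [difficulty: open-problem] (why it might
fail: Needs the class within a factor ε^(n²) of the smooth value n(n-1)^(n²-2): one singular stratum
absorbing a (1-ε^(n²)) fraction of the polar multiplicity kills it while PermanentClassExp survives;
no data at all beyond class(P_2) = 2.) [arXiv:2606.13628, Piene1978, Landsberg2017]
#9 BezoutToSuperquadratic (support) — pure arithmetic, provable now: for α > 0 and any m : ℕ → ℕ, if
n^(α·n²) ≤ B(m_n, n·n) for all large n (B written as the closed-form sum with N = n·n) then for some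
ε > 0 (ε = α/2 works), n^(2+ε) ≤ m_n for all large n. Via B(m,N) ≤ 2^(N-2)·C(2m-1,N-1) (Vandermonde
sub-sum) ≤ (4em/(N-1))^(N-1) (C(a,k) ≤ (ea/k)^k), arXiv:2606.13628 Lemma 18, then (N-1)-st roots: m
≥ (N-1)·n^(αN/(N-1))/(4e) ≥ n^(2+α)/(8e). [difficulty: provable-now] [arXiv:2606.13628]
#9 CubicFromFullClass (support) — the card's headline as glue, provable now from the two named
decls: KernelIncidenceBound → PermanentClassFull → ∃ c > 0, c·n³ ≤ dc(per_n) for all large n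
(instantiate the bound at f = per_n with m = dc(per_n) — perPoly_isHomogeneous,
hasDetRepr_determinantalComplexity_holds, |Fin n × Fin n| = n·n — then (εn)^(n²) ≤ B(dc, n²) <
(4e·dc/(n²-1))^(n²-1) forces dc > (n²-1)·εn/(4e) ≥ ε n³/(8e)). [difficulty: provable-now]
[arXiv:2606.13628,
Literature.Computability.AlgebraicComplexity.hasDetRepr_determinantalComplexity_holds]
#9 ClassCollapse (support) — NEGATIVE SIDE (kill criterion, filed unranked for refuters): class(P_n)
= n^(o(n²)) — for every α > 0 and all large n, every finite genuine polar set T(per_n; a, b, c) with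
a, b linearly independent has fewer than n^(α·n²) points. Its proof closes the engine below any
super-quadratic payoff (what remains is exactly Mignon–Ressayre's n²/2 from class ≥ 1); the n = 3, 4
computations of the Cheapest falsifier are its first test, and a det-like collapse mechanism (a
permanental Cramer-type identity along Sing(P_n)) would itself be news for every per-vs-det route.
[difficulty: open-problem] [Landsberg2017, arXiv:2606.13628, arXiv:1004.4802]

TWO-LAYER PLAN. Foreseen glued splits (k ≤ 3, depth 1; nothing filed now). PermanentClassExp ⇐
PolarFormula (a Piene/Teissier-type identity class(P_n) =
n(n-1)^(n²-2) − Σ_strata corrections over the torus-stable stratification of Sing(P_n)) →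
CorrectionBound (the corrections leave n^(αn²)) →
PermanentClassExp; alternatively PermanentClassExp ⇐ OrbitSemicontinuity (class does not increase
along GL_{n²}-orbit degenerations with
nondegenerate dual limit) → LimitClass (an explicit orbit limit of per_n with class ≥ n^(αn²)) →
PermanentClassExp. KernelIncidenceBound ⇐
RefinedBezout (isolated zeros of a section of a globally generated split bundle on a product of
projective spaces ≤ top Chern number) →
LocalGraph (Schur-complement normal form + conormal identity, 2606.13628 Step 5) →
KernelIncidenceBound. Later support, not now: the BORDER
payoff (2606.13628 §§4–7 transfer for per: PermanentClassExp ⟹ border-dc(per_n) ≥ n^(2+α/2), feeding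
route GCTMult), and the symmetric
variant (one kernel line, 2^(N-2)·C(m,N-1), card one-kernel-line-sdc).

KILL CRITERIA. ClassCollapse proved (class(P_n) = n^(o(n²))) ⟹ `close --reason
refuted:PermanentClassExp` — the engine then provably returns only Θ(n²)
(class ≥ 1 ⟺ Mignon–Ressayre); evidence short of proof: class(P_3), class(P_4) far below 384 and
4·3^14 in a det-like pattern ⟹ dormant.
KernelIncidenceBound refuted (an explicit affine determinant and pencil with more than B(m,N)
genuine polar points — cheap to hunt on random
small (m, N)) ⟹ `close --reason refuted:KernelIncidenceBound`: the whole engine dies, Sheshadri's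
power-sum theorems with it.
PermanentClassFull refuted alone ⟹ drop it and CubicFromFullClass (not load-bearing for the
Assembly). DetqpSuperquadratic proved by another
route ⟹ close superseded.

NOT DECOMPOSED YET. Which formula computes class(P_n) (Piene polar classes vs Teissier polar
multiplicities along the strata of Sing(P_n), whose codimension is
known only for n = 3, 4: Landsberg2017 Question 6.3.3.7); the transversal type along the top
singular stratum; torus-equivariant
localisation; the border transfer for the permanent (2606.13628 §10 item 7, Lemma 12 'covector'
generalised); the symmetric (sdc) variant;
constants (4e, 8e) are deliberately loose. All are layer-2 children or --supports lemmas, later.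

CHEAPEST FALSIFIER. Compute class(P_3) exactly (N = 9, smooth Plücker value 3·2^7 = 384): random a,
b, c ∈ F_p^9 (p ≈ 2^30) or ℚ^9, ideal
(per_3, q_1(∇per_3), …, q_7(∇per_3), c·x − 1) with q_1..q_7 a basis of ann(span(a,b)), saturate by
the nine 2×2 sub-permanents (= ∇per_3,
removes Sing), count points (msolve / Singular / Macaulay2: minutes; or homotopy continuation, 1
cubic + 7 quadrics + 1 linear, ≤ 384 paths).
Controls in the same script: det_3 gives 0 (dual Seg(P²×P²) has dimension 4 < 7), a random cubic in
9 variables gives 384, random linear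
determinants of size m in N = 3, 4 variables respect B(m,3) = 3·C(m,2), B(4,4) = 52 (sanity test of
KernelIncidenceBound). Reading:
class(P_3) = O(10) with a recognisable closed form is evidence for ClassCollapse (go dormant);
class(P_3) a sizeable fraction of 384 and
class(P_4) (16 variables, ≤ 1.9·10^7 paths by monodromy / polyhedral homotopy with the torus
symmetry, a kit job of hours) growing like
4^(16α) is evidence for PermanentClassExp. Not run in this seat (compute-free hub, no CAS);
recommended as the refuter's first kit job, shared
with card polar-degree-baur-strassen's d_N(per_3) computation.

NUMBERS. dc(per_n) ≥ n²/2 (MignonRessayre2004; tree: sq_le_two_mul_of_hasDetRepr_perPoly), dc(per_n)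
≤ 2^n − 1 (Grenet2011; determinantalComplexity_perPoly_le),
dc(per_3) = 7 (AlperBogartVelasco2017). Class of a smooth degree-d hypersurface in P^(N-1):
d(d-1)^(N-2) (Plücker–Piene); at (d, N) = (n, n²):
n(n-1)^(n²-2) ≈ e^(-n)·n^(n²-1); class(P_2) = 2 (smooth quadric in P³), class(P_3) ≤ 384, class(P_4)
≤ 4·3^14 = 19131876, class(P_n) ≥ 1
(Landsberg2017 Lemma 6.4.6.3). B(m, N) = Σ_{i=1}^{N-1} C(m,i)C(m-1,N-1-i)C(N-2,i-1) ≤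
2^(N-2)C(2m-1,N-1) ≤ (4em/(N-1))^(N-1) (arXiv:2606.13628
Lemma 18); B(m,3) = 3C(m,2); B(4,4) = 52; B(m,N) > 0 iff m ≥ N/2. Exponent dictionary: class(P_n) ≥
n^(αn²) ⟹ dc(per_n) ≥ (n²-1)n^α/(4e) ≥
n^(2+α)/(8e); class ≥ (εn)^(n²) ⟹ dc ≥ ε n³/(8e); ceiling (class ≤ n^(n²-1)) ⟹ at most n³/(4e) from
this method. Power sums for comparison:
dc(Σx_i^n) ≥ (n-1)²/(4e), sdc ≥ (n-1)²/(2e), exact and border (arXiv:2606.13628 Thms 1–2, Cor 1).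
Items at open: 8 (1 target, 3 cruxes,
3 support, 1 assembly).

DEFINITION REQUESTS. None needed to open: the genuine polar set is inlined in each statement. Useful
later (not blocking, not filed): a Literature notion of the
class / dual degree of a projective hypersurface with the fact 'class = number of genuine polar
points of a generic pencil = max over finite
pencils' (Piene1978; Landsberg2017 §6.4.3), which would let KernelIncidenceBound be restated as
arXiv:2606.13628 Thm 3(i) verbatim and
PermanentClassExp as 'deg Z(per_n)^∨ ≥ n^(αn²)'. Bib entries added this session: Piene1978
(doi:10.24033/asens.1346), Sheshadri2026Border
(arXiv:2606.13628), Sheshadri2026SDC (arXiv:2606.11090).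

Novelty: Searches (2026-08-15): `lit read arxiv:2606.11090` (all 13 pp.) and `lit read arxiv:2606.13628` (pp.
2–10, 17–19: Thm 3, Lemmas 1–6, 18,
Prop 2, Remark 3, §10); `lit search --hybrid "degree of the dual variety of the permanent
hypersurface class polar"` (10 book hits; Landsberg2017
PDF pp. 168–172 read: dual of Z(perm_m) nondegenerate, degree not discussed); `lit frontier
ValiantsHypothesis --since 2024` (30 rows; the two
Sheshadri preprints are the only polar-degree items); `lit search --source zbmath "dual variety
permanent hypersurface"` (0); `lit search
--source crossref "polar degree permanent"` (0 relevant); `lit galaxy search "dual variety of the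
permanent hypersurface" --star all` (0 rows,
pdf/crabby stars timed out); openalex and arxiv APIs rate-limited (HTTP 429) this session; `ledger
negatives` (0).
Nearest prior art found: arXiv:2606.13628 — its Thm 3(i) IS crux KernelIncidenceBound for arbitrary
(singular, reducible, non-reduced) affine
determinants, Lemma 18 is the estimate, and §10 item 7 with Open Question (2) states the permanent
application conditionally on exactly crux
PermanentClassExp; arXiv:2606.11090 (smooth symmetric case, read by the card); Landsberg2017 Lemma
6.4.6.3 / Prop 6.4.5.1 (class(P_n) ≥ 1);
arXiv:1004.4802 (dual DIMENSION ⟹ border m²/2); sibling cards polar-degree-baur-strassen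
(d_N(per_n), Baur–Strassen payoff) and
one-kernel-line-sdc (dimension version).
Delta: none in mechanism — the line is Sheshadri's own conditional programme for the p  [refs: 2606.11090, 2606.13628, 1004.4802, arxiv:2606.11090, arxiv:2606.13628, Landsberg2017]

Barriers (technique_class: polar-degree, kernel-incidence-bezout, class-of-dual): - technique_class: polar-degree, kernel-incidence-bezout, class-of-dual
- Literature.Barriers.ValiantsHypothesis.RankMethods: does not apply formally — EGOW18 kills
sub-additive rank measures μ_L(f) = rank L(f); the class is the degree of a discriminant-type
object, multiplicative under the kernel lift, not the rank of a linear image of per_n; this is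
exactly why it can exceed the #variables wall N that caps MR04 / LMR13 / ABV17.
- Literature.Barriers.ValiantsHypothesis.RankLifting: same — no lifted-rank (GMOW19) certificate is
used anywhere.
- Literature.Barriers.ValiantsHypothesis.ShiftedPartialsCannotSeparate: not a flattening; ELSW18
concerns equations of flattening type for padded per vs det_n; the polar count is a condition
quantified over points of Z(per_n), like MR04, outside that class — necessary, not sufficient
(Landsberg2017 Rem 6.4.6.5): the bet is the one number class(P_n).
- Literature.Barriers.ValiantsHypothesis.PartialDerivativesDetPerm: idem — dimensions of spaces of
partials are ≤ poly(N); the route's invariant is n^(Θ(N))-sized by design and enters through an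
(N-1)-st root.
- Literature.Barriers.ValiantsHypothesis.PermanentCharTwo: consistent and used — everything is over
ℂ; in characteristic 2 per = det has a degenerate dual (class 0) and Sheshadri's bound fails
uniformly in positive characteristic (arXiv:2606.11090 Rem 3, arXiv:2606.13628 §10), so no
characteristic-free statement (CharacteristicFreeDcLowerBound) is asserted.
- Literature.Barriers.Valiant

Novelty grade: known — ROUTE REVIEW (refuter rreview-9955905d, 2026-08-15). 8/8 decls elaborate (probe rc0); 0 refuted, 0 vacuous. Assembly PROVED and attached to 5217 (PC_Assembly.lean rc0, 0 sorries, whitelist axioms); target 0318 = DetQP.DetqpSuperquadratic by rfl (already checked). Layers sound: KIB ∧ PCE ∧ B2S ⊢ targ (refuter refuter-rreview-route-ValiantsHypothesis-9955905d-0, 2026-08-15T14:00:43Z; prior: arXiv:2606.13628 (Thm 3(i), Lemma 18, §10 item 7 / Open Question (2)); arXiv:2606.11090; Landsberg2017 Lemma 6.4.6.3; MignonRessayre2004; stmt-ValiantsHypothesis-4915 (BirkhoffNewtonClass.DeterminantalConormalBound); Literature.Computability.AlgebraicComplexity.Sheshadri2026_polarCount_le)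

History (route lifecycle, newest last):
- 2026-08-15T13:51:34Z · CLOSED retired — not-a-thesis: assembly does not conclude the sub-problem Statement (operator:999:1257524)

sub-problem: ValiantsHypothesis · status: closed(retired) · opened planner-plancard-ValiantsHypothesis-ValiantsH-f1f3c815-0 2026-08-15T11:40:22Z · rev 0 · ledger route-ValiantsHypothesis-PermanentClass
GENERATED by the gate from the ledger (D-0016/17). Provers cite these decls: `theorem foo : Summit.ValiantsHypothesis.ValiantsHypothesis.Theses.PermanentClass.<Decl> := …` in Summits/ValiantsHypothesis/ValiantsHypothesis/Theorems/<Name>.lean.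
-/

namespace Summit.ValiantsHypothesis.ValiantsHypothesis.Theses.PermanentClass

open scoped BigOperators Topology Manifold Classical MeasureTheory ProbabilityTheory Matrix InnerProductSpace ComplexConjugate ContinuousMap
open Filter Set Function TopologicalSpace MeasureTheory

attribute [summit_statement] _root_.ValiantsHypothesis

open Literature.PNP

/-- item stmt-ValiantsHypothesis-0318 · target · rank 0 · open · by planner
why it might fail: all engines in print saturate at Θ(n²) (MR04 Hessian, LMR13 dual dimension, ABV17 singular locus; Landsberg2017 Rem 6.4.6.5) and dc(per_n) = O(n²) is excluded by nothing known; this engine reaches it only if class(P_n) ≥ n^(Ω(n²)).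
sources: MignonRessayre2004, arXiv:1004.4802, arXiv:1505.02205, Landsberg2017, arXiv:2606.13628
Break the Hessian-rank ceiling: known dc(per_n) ≥ n^2/2 [MignonRessayre2004 Thm 1.1; CaiChenLi2010],
dc(per_3)=7 [AlperBogartVelasco2017]; upper bound 2^n-1 [Grenet2011]. Any ε>0 requires a new
invariant of the determinant hypersurface (higher fundamental forms / singular-locus flattenings).
Most informative crux of the route. -/
@[route_item "route-ValiantsHypothesis-PermanentClass"]
def DcPerSuperquadratic : Prop :=
  ∃ ε : ℝ, 0 < ε ∧ ∃ n₀ : ℕ, ∀ n ≥ n₀, (n : ℝ) ^ (2 + ε) ≤ (Literature.Computability.AlgebraicComplexity.determinantalComplexity (Literature.Computability.AlgebraicComplexity.perPoly (Fin n) ℂ) : ℝ)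

/-- item stmt-ValiantsHypothesis-5211 · crux · rank 2 · closed · moot by None · by planner
why it might fail: In print only as an unrefereed, LLM-assisted 2026 preprint (arXiv:2606.13628 Thm 3(i)); delicate steps are the generic Λ-reduction of the right-kernel block (Step 3, Rem 1) and Fulton positivity with excess components (Lemma 5); as filed it also covers non-transverse finite pencils.
sources: arXiv:2606.13628, arXiv:2606.11090, Fulton1998, Piene1978
[crux] Sheshadri's determinantal conormal bound in elementary polar-count form (card item P0, which
claimed it as a new 'singular extension'; it is arXiv:2606.13628 Thm 3(i) + Remark 3, no smoothness,
reducible and non-reduced det Â allowed): for a finite index type σ with N = |σ|, a form f ∈ ℂ[x_σ]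
homogeneous of degree d with HasDetRepr f m (f = det A, A an m×m matrix of affine-linear forms),
vectors a, b, c : σ → ℂ with a, b linearly independent, IF the genuine polar set T = {x : f(x) = 0,
Σ c_i x_i = 1, ∇f(x) ≠ 0, ∇f(x) ∈ span(a,b)} is finite THEN #T ≤ B(m,N) = Σ_{j=0}^{N-2}
C(m,j+1)·C(m-1,N-2-j)·C(N-2,j). Proof in print: homogenise Â = x₀A₀ + Σ x_i A_i, F = det Â =
x₀^(m-d) f ≢ 0 (f = 0 gives T = ∅); each x ∈ T gives the point [1:x] of the cone over V(f), a smooth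
point of V(F)_red on a multiplicity-one component with dF ≠ 0 (Lemma 2 dichotomy), hence a 'count
point'; Steps 2–5 (rank m-1, kernel lift, generic Λ-reduction, Schur-complement local graph,
conormal identity ∂_iF = det B · uᵀÂ_i v) show its lift is an ISOLATED point of the square system
(isolated because T is finite near x — transversality of the flag is not needed, a non-reduced
isolated lift is charged its length -/
@[route_item "route-ValiantsHypothesis-PermanentClass"]
def KernelIncidenceBound : Prop :=
  ∀ {σ : Type} [Fintype σ] [DecidableEq σ] (f : MvPolynomial σ ℂ) (d m : ℕ), f.IsHomogeneous d → Literature.Computability.AlgebraicComplexity.HasDetRepr f m → ∀ a b c : σ → ℂ, LinearIndependent ℂ ![a, b] → {x : σ → ℂ | MvPolynomial.eval x f = 0 ∧ ∑ i, c i * x i = 1 ∧ (∃ i, MvPolynomial.eval x (MvPolynomial.pderiv i f) ≠ 0) ∧ ∃ p : ℂ × ℂ, ∀ i, MvPolynomial.eval x (MvPolynomial.pderiv i f) = p.1 * a i + p.2 * b i}.Finite → {x : σ → ℂ | MvPolynomial.eval x f = 0 ∧ ∑ i, c i * x i = 1 ∧ (∃ i, MvPolynomial.eval x (MvPolynomial.pderiv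 i f) ≠ 0) ∧ ∃ p : ℂ × ℂ, ∀ i, MvPolynomial.eval x (MvPolynomial.pderiv i f) = p.1 * a i + p.2 * b i}.ncard ≤ ∑ j ∈ Finset.range (Fintype.card σ - 1), m.choose (j + 1) * (m - 1).choose (Fintype.card σ - 2 - j) * (Fintype.card σ - 2).choose j

/-- item stmt-ValiantsHypothesis-5212 · crux · rank 3 · closed · moot by None · by planner
why it might fail: Only class(P_n) ≥ 1 is known (dual nondegenerate); Sing(P_n) has codimension ≤ 2n and the Plücker–Teissier corrections it carries could collapse the class to n^(o(n²)), the way Cramer's rule collapses det's dual to dimension 2n-2 — then the engine returns only Θ(n²).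
sources: arXiv:2606.13628, Landsberg2017, MignonRessayre2004, Piene1978, arXiv:1505.02205
[crux] CLASS CONJECTURE, exponent form (card item (C) weakened to what the Target needs; =
arXiv:2606.13628 §10 Open Question (2)): there are α > 0 and n₀ such that for every n ≥ n₀ some
pencil (a, b linearly independent) and slice c give a FINITE genuine polar set T(per_n; a, b, c) =
{x ∈ ℂ^(n×n) : per_n(x) = 0, Σ c_i x_i = 1, ∇per_n(x) ≠ 0, ∇per_n(x) ∈ span(a,b)} with #T ≥
n^(α·n²). Equivalently (generic pencils realise the maximum over finite ones; Z(per_n)^∨ is a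
hypersurface by Landsberg2017 Lemma 6.4.6.3 + Prop 6.4.5.1) the class deg Z(per_n)^∨ is ≥ n^(αn²).
This is the mathematical heart of the route; attack lines: Piene/Teissier polar-class formulas along
the torus-stable stratification of Sing(P_n) (transversal type A₁ along the top stratum: matrices
with two zero rows, normal form e₁ᵀ C e₂ with C the (n-2)-subpermanents), upper semicontinuity of
the class along GL-orbit degenerations (class(P_n) ≥ class of any orbit limit with nondegenerate
dual), torus-equivariant localisation of polar classes, and certified numerics at n = 3, 4.
[difficulty: open-problem] -/
@[route_item "route-ValiantsHypothesis-PermanentClass"]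
def PermanentClassExp : Prop :=
  ∃ α : ℝ, 0 < α ∧ ∃ n₀ : ℕ, ∀ n ≥ n₀, ∃ a b c : Fin n × Fin n → ℂ, LinearIndependent ℂ ![a, b] ∧ {x : Fin n × Fin n → ℂ | MvPolynomial.eval x (Literature.Computability.AlgebraicComplexity.perPoly (Fin n) ℂ) = 0 ∧ ∑ i, c i * x i = 1 ∧ (∃ i, MvPolynomial.eval x (MvPolynomial.pderiv i (Literature.Computability.AlgebraicComplexity.perPoly (Fin n) ℂ)) ≠ 0) ∧ ∃ p : ℂ × ℂ, ∀ i, MvPolynomial.eval x (MvPolynomial.pderiv i (Literature.Computability.AlgebraicComplexity.perPoly (Fin n) ℂ)) = p.1 * a i + p.2 * b i}.Finite ∧ (n : ℝ) ^ (α * (n : ℝ) ^ 2) ≤ ({x : Fin n × Fin n → ℂ | MvPolynomial.eval x (Literature.Computability.AlgebraicComplexity.perPoly (Fin n) ℂ) = 0 ∧ ∑ i, c i * x i = 1 ∧ (∃ i, MvPolynomial.eval x (MvPolynomial.pderiv i (Literature.Computability.AlgebraicComplexity.perPoly (Fin n) ℂ)) ≠ 0) ∧ ∃ p : ℂ ×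 ℂ, ∀ i, MvPolynomial.eval x (MvPolynomial.pderiv i (Literature.Computability.AlgebraicComplexity.perPoly (Fin n) ℂ)) = p.1 * a i + p.2 * b i}.ncard : ℝ)

/-- item stmt-ValiantsHypothesis-5213 · crux · rank 4 · closed · moot by None · by planner
why it might fail: Needs the class within a factor ε^(n²) of the smooth value n(n-1)^(n²-2): one singular stratum absorbing a (1-ε^(n²)) fraction of the polar multiplicity kills it while PermanentClassExp survives; no data at all beyond class(P_2) = 2.
sources: arXiv:2606.13628, Piene1978, Landsberg2017
[crux] CLASS CONJECTURE, full-exponent form (card item (C) as filed): there are ε > 0 and n₀ such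
that for all n ≥ n₀ some finite genuine polar set of per_n (pencil a, b linearly independent, slice
c, as in PermanentClassExp) has at least (ε·n)^(n²) points, i.e. class(P_n) ≥ (εn)^(n²) — within a
factor ε^(n²) of the smooth Plücker value n(n-1)^(n²-2). With KernelIncidenceBound this gives the
card's dc(per_n) ≥ ε·n³/(8e) (support CubicFromFullClass), the maximal reach of the method. [deps:
PermanentClassExp] [difficulty: open-problem] -/
@[route_item "route-ValiantsHypothesis-PermanentClass"]
def PermanentClassFull : Prop :=
  ∃ ε : ℝ, 0 < ε ∧ ∃ n₀ : ℕ, ∀ n ≥ n₀, ∃ a b c : Fin n × Fin n → ℂ, LinearIndependent ℂ ![a, b] ∧ {x : Fin n × Fin n → ℂ | MvPolynomial.eval x (Literature.Computability.AlgebraicComplexity.perPoly (Fin n) ℂ) = 0 ∧ ∑ i, c i * x i = 1 ∧ (∃ i, MvPolynomial.eval x (MvPolynomial.pderiv i (Literature.Computability.AlgebraicComplexity.perPoly (Fin n) ℂ)) ≠ 0) ∧ ∃ p : ℂ × ℂ, ∀ i, MvPolynomial.eval x (MvPolynomial.pderiv i (Literature.Computability.AlgebraicComplexity.perPoly (Fin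 n) ℂ)) = p.1 * a i + p.2 * b i}.Finite ∧ (ε * (n : ℝ)) ^ (n ^ 2) ≤ ({x : Fin n × Fin n → ℂ | MvPolynomial.eval x (Literature.Computability.AlgebraicComplexity.perPoly (Fin n) ℂ) = 0 ∧ ∑ i, c i * x i = 1 ∧ (∃ i, MvPolynomial.eval x (MvPolynomial.pderiv i (Literature.Computability.AlgebraicComplexity.perPoly (Fin n) ℂ)) ≠ 0) ∧ ∃ p : ℂ × ℂ, ∀ i, MvPolynomial.eval x (MvPolynomial.pderiv i (Literature.Computability.AlgebraicComplexity.perPoly (Fin n) ℂ)) = p.1 * a i + p.2 * b i}.ncard : ℝ)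

/-- item stmt-ValiantsHypothesis-5214 · support · rank 9 · closed · moot by None · by planner
sources: arXiv:2606.13628
[support] pure arithmetic, provable now: for α > 0 and any m : ℕ → ℕ, if n^(α·n²) ≤ B(m_n, n·n) for
all large n (B written as the closed-form sum with N = n·n) then for some ε > 0 (ε = α/2 works),
n^(2+ε) ≤ m_n for all large n. Via B(m,N) ≤ 2^(N-2)·C(2m-1,N-1) (Vandermonde sub-sum) ≤
(4em/(N-1))^(N-1) (C(a,k) ≤ (ea/k)^k), arXiv:2606.13628 Lemma 18, then (N-1)-st roots: m ≥
(N-1)·n^(αN/(N-1))/(4e) ≥ n^(2+α)/(8e). [difficulty: provable-now] -/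
@[route_item "route-ValiantsHypothesis-PermanentClass"]
def BezoutToSuperquadratic : Prop :=
  ∀ α : ℝ, 0 < α → ∀ m : ℕ → ℕ, (∃ n₀ : ℕ, ∀ n ≥ n₀, (n : ℝ) ^ (α * (n : ℝ) ^ 2) ≤ ((∑ j ∈ Finset.range (n * n - 1), (m n).choose (j + 1) * (m n - 1).choose (n * n - 2 - j) * (n * n - 2).choose j : ℕ) : ℝ)) → ∃ ε : ℝ, 0 < ε ∧ ∃ n₀ : ℕ, ∀ n ≥ n₀, (n : ℝ) ^ (2 + ε) ≤ (m n : ℝ)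

/-- item stmt-ValiantsHypothesis-5215 · support · rank 9 · closed · moot by None · by planner
sources: arXiv:2606.13628, Literature.Computability.AlgebraicComplexity.hasDetRepr_determinantalComplexity_holds
[support] the card's headline as glue, provable now from the two named decls: KernelIncidenceBound →
PermanentClassFull → ∃ c > 0, c·n³ ≤ dc(per_n) for all large n (instantiate the bound at f = per_n
with m = dc(per_n) — perPoly_isHomogeneous, hasDetRepr_determinantalComplexity_holds, |Fin n × Fin
n| = n·n — then (εn)^(n²) ≤ B(dc, n²) < (4e·dc/(n²-1))^(n²-1) forces dc > (n²-1)·εn/(4e) ≥ ε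
n³/(8e)). [difficulty: provable-now] -/
@[route_item "route-ValiantsHypothesis-PermanentClass"]
def CubicFromFullClass : Prop :=
  KernelIncidenceBound → PermanentClassFull → ∃ c : ℝ, 0 < c ∧ ∃ n₀ : ℕ, ∀ n ≥ n₀, c * (n : ℝ) ^ 3 ≤ (Literature.Computability.AlgebraicComplexity.determinantalComplexity (Literature.Computability.AlgebraicComplexity.perPoly (Fin n) ℂ) : ℝ)

/-- item stmt-ValiantsHypothesis-5216 · support · rank 9 · closed · moot by None · by planner
sources: Landsberg2017, arXiv:2606.13628, arXiv:1004.4802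
[support] NEGATIVE SIDE (kill criterion, filed unranked for refuters): class(P_n) = n^(o(n²)) — for
every α > 0 and all large n, every finite genuine polar set T(per_n; a, b, c) with a, b linearly
independent has fewer than n^(α·n²) points. Its proof closes the engine below any super-quadratic
payoff (what remains is exactly Mignon–Ressayre's n²/2 from class ≥ 1); the n = 3, 4 computations of
the Cheapest falsifier are its first test, and a det-like collapse mechanism (a permanental
Cramer-type identity along Sing(P_n)) would itself be news for every per-vs-det route. [difficulty:
open-problem] -/
@[route_item "route-ValiantsHypothesis-PermanentClass"]
def ClassCollapse : Prop :=
  ∀ α : ℝ, 0 < α → ∃ n₀ : ℕ, ∀ n ≥ n₀, ∀ a b c : Fin n × Fin n → ℂ, LinearIndependent ℂ ![a, b] → {x : Fin n × Fin n → ℂ | MvPolynomial.eval x (Literature.Computability.AlgebraicComplexity.perPoly (Fin n) ℂ) = 0 ∧ ∑ i, c i * x i = 1 ∧ (∃ i, MvPolynomial.eval x (MvPolynomial.pderiv i (Literature.Computability.AlgebraicComplexity.perPoly (Fin n) ℂ)) ≠ 0) ∧ ∃ p : ℂ × ℂ, ∀ i, MvPolynomial.eval x (MvPolynomial.pderiv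 i (Literature.Computability.AlgebraicComplexity.perPoly (Fin n) ℂ)) = p.1 * a i + p.2 * b i}.Finite → ({x : Fin n × Fin n → ℂ | MvPolynomial.eval x (Literature.Computability.AlgebraicComplexity.perPoly (Fin n) ℂ) = 0 ∧ ∑ i, c i * x i = 1 ∧ (∃ i, MvPolynomial.eval x (MvPolynomial.pderiv i (Literature.Computability.AlgebraicComplexity.perPoly (Fin n) ℂ)) ≠ 0) ∧ ∃ p : ℂ × ℂ, ∀ i, MvPolynomial.eval x (MvPolynomial.pderiv i (Literature.Computability.AlgebraicComplexity.perPoly (Fin n) ℂ)) = p.1 * a i + p.2 * b i}.ncard : ℝ) < (n : ℝ) ^ (α * (n : ℝ) ^ 2)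

/-- item stmt-ValiantsHypothesis-5217 · assembly · rank 1 · closed · moot by None · by planner
sources: arXiv:2606.13628, Literature.Computability.AlgebraicComplexity.hasDetRepr_determinantalComplexity_holds, MignonRessayre2004
[assembly] KernelIncidenceBound → PermanentClassExp → BezoutToSuperquadratic →
(DetQP.DetqpSuperquadratic verbatim: ∃ ε > 0, ∃ n₀, ∀ n ≥ n₀, n^(2+ε) ≤ dc(per_n)). -/
@[route_item "route-ValiantsHypothesis-PermanentClass"]
def Assembly : Prop :=
  KernelIncidenceBound → PermanentClassExp → BezoutToSuperquadratic → ∃ ε : ℝ, 0 < ε ∧ ∃ n₀ : ℕ, ∀ n ≥ n₀, (n : ℝ) ^ (2 + ε) ≤ (Literature.Computability.AlgebraicComplexity.determinantalComplexity (Literature.Computability.AlgebraicComplexity.perPoly (Fin n) ℂ) : ℝ)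

end Summit.ValiantsHypothesis.ValiantsHypothesis.Theses.PermanentClass
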